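import Mathlib
import Summits.ValiantsHypothesis.ValiantsHypothesis.Theorems.BarrierLeverTransversalMinorLayoutsCompressionBase

/-!
# Route BarrierLever — conjecture TT (stmt-ValiantsHypothesis-19152): compound-minor pairings, part 3 —
# simultaneous genericity, the CONE lemma, and the PAIR SPLIT

Notation of parts 1–2 (`…CompressionBase`, `…Compression`): for families `F F' : κ → α → ι` the
pairing matrix is `P_g[j, i] := det (g.submatrix (F j) (F' i))`, and `(F, F')` is GOOD when
`det P_g ≠ 0` for some `g`.  This part supplies the remaining structural moves of the calculus used
on the 𝒟-side (memo HOME/val-np-p2/COMPRESSION-MEMO-g2.md; the cell's "four-way balanced split"):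

* `pairing_det_eq_eval` / `pairing_good_and` (SIMULTANEOUS GENERICITY): `det P_g` is the evaluation
  at `g` of a fixed polynomial in the entries (generic matrix `Matrix.mvPolynomialX`); hence two good
  pairs are good at one common `g`.
* `pairing_good_cone` (CONE LEMMA): if `(L, L')` is good and `s` is a symbol used by no member, then
  the cones `(s * L, s * L')` (members `Option α`-indexed, `none ↦ s`) are good — `g ↦ 1 ⊕ g`.
* `pairing_good_split` (PAIR / VERTEX SPLIT): for families given in cone form over two distinct
  symbols — the `κ₁`-indexed members are cones over `x`, the `κ₂`-indexed ones cones over `y`, on both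
  sides with the same index types — goodness of the two link pairings implies goodness of the whole
  pairing: for `g` with rows `x`, `y` replaced by unit vectors the pairing matrix is block diagonal
  with the two link pairings of the SAME `g` as blocks (this is where simultaneous genericity enters).

All statements definition-free, Mathlib only.  WHAT THIS IS NOT: no new case of TT by itself; nothing
on crux 14610 / VP vs VNP.
-/

-- layout Summits/ValiantsHypothesis/ValiantsHypothesis forces the duplicated namespace component
set_option linter.dupNamespace false

open Matrix Finset

namespace Summit.ValiantsHypothesis.ValiantsHypothesis.Theorems.BarrierLever.Compression

variable {κ α ι : Type*} [Fintype κ] [DecidableEq κ] [Fintype α] [DecidableEq α]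
  [Fintype ι] [DecidableEq ι]

/-! ## 1. Simultaneous genericity -/

omit [Fintype ι] [DecidableEq ι] in
/-- The pairing determinant is the evaluation at `g` of the pairing determinant of the generic
matrix. -/
theorem pairing_det_eq_eval (F F' : κ → α → ι) (g : Matrix ι ι ℂ) :
    (Matrix.of fun j i => (g.submatrix (F j) (F' i)).det).det =
      MvPolynomial.eval (fun p : ι × ι => g p.1 p.2)
        (Matrix.of fun j i =>
          ((Matrix.mvPolynomialX ι ι ℂ).submatrix (F j) (F' i)).det).det := by
  symm
  rw [RingHom.map_det]
  congr 1
  ext j i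
  simp only [RingHom.mapMatrix_apply, map_apply, of_apply]
  rw [RingHom.map_det]
  congr 1
  ext a b
  simp only [RingHom.mapMatrix_apply, map_apply, submatrix_apply, Matrix.mvPolynomialX_apply,
    MvPolynomial.eval_X]

omit [Fintype ι] [DecidableEq ι] in
/-- SIMULTANEOUS GENERICITY: two good pairs (over the same symbol type, arbitrary index types) are
good at a common matrix `g`. -/
theorem pairing_good_and {κ₁ α₁ κ₂ α₂ : Type*} [Fintype κ₁] [DecidableEq κ₁] [Fintype α₁]
    [DecidableEq α₁] [Fintype κ₂] [DecidableEq κ₂] [Fintype α₂] [DecidableEq α₂]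
    (F₁ F₁' : κ₁ → α₁ → ι) (F₂ F₂' : κ₂ → α₂ → ι)
    (h₁ : ∃ g : Matrix ι ι ℂ, (Matrix.of fun j i => (g.submatrix (F₁ j) (F₁' i)).det).det ≠ 0)
    (h₂ : ∃ g : Matrix ι ι ℂ, (Matrix.of fun j i => (g.submatrix (F₂ j) (F₂' i)).det).det ≠ 0) :
    ∃ g : Matrix ι ι ℂ, (Matrix.of fun j i => (g.submatrix (F₁ j) (F₁' i)).det).det ≠ 0 ∧
      (Matrix.of fun j i => (g.submatrix (F₂ j) (F₂' i)).det).det ≠ 0 := by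
  classical
  set p₁ := (Matrix.of fun j i =>
      ((Matrix.mvPolynomialX ι ι ℂ).submatrix (F₁ j) (F₁' i)).det).det with hp₁
  set p₂ := (Matrix.of fun j i =>
      ((Matrix.mvPolynomialX ι ι ℂ).submatrix (F₂ j) (F₂' i)).det).det with hp₂
  have hne₁ : p₁ ≠ 0 := by
    rintro h0
    obtain ⟨g, hg⟩ := h₁
    apply hg
    rw [pairing_det_eq_eval, ← hp₁, h0, map_zero]
  have hne₂ : p₂ ≠ 0 := by
    rintro h0
    obtain ⟨g, hg⟩ := h₂
    apply hg
    rw [pairing_det_eq_eval, ← hp₂, h0, map_zero]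
  have hne : p₁ * p₂ ≠ 0 := mul_ne_zero hne₁ hne₂
  -- a nonzero polynomial over ℂ has a non-root
  have hex : ∃ v : ι × ι → ℂ, MvPolynomial.eval v (p₁ * p₂) ≠ 0 := by
    by_contra hall
    push Not at hall
    exact hne (MvPolynomial.funext fun v => by rw [hall v, map_zero])
  obtain ⟨v, hv⟩ := hex
  rw [map_mul] at hv
  refine ⟨Matrix.of fun x y => v (x, y), ?_, ?_⟩
  · rw [pairing_det_eq_eval]
    have : (fun p : ι × ι => (Matrix.of fun x y => v (x, y)) p.1 p.2) = v := by
      ext ⟨x, y⟩; rfl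
    rw [this, ← hp₁]
    exact left_ne_zero_of_mul hv
  · rw [pairing_det_eq_eval]
    have : (fun p : ι × ι => (Matrix.of fun x y => v (x, y)) p.1 p.2) = v := by
      ext ⟨x, y⟩; rfl
    rw [this, ← hp₂]
    exact right_ne_zero_of_mul hv

/-! ## 2. The cone lemma -/

omit [Fintype ι] in
/-- The cone minor: for `G = 1 ⊕ g` (unit row/column at the apex `s`), the minor of `G` on the
cones over `s` of a row tuple `R` and a column tuple `C` avoiding `s` is the minor of `g` on
`(R, C)`. -/
theorem det_cone_minor (g : Matrix ι ι ℂ) (s : ι) (R C : α → ι) (hR : ∀ a, R a ≠ s)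
    (hC : ∀ b, C b ≠ s) :
    ((Matrix.of fun x y : ι =>
        if x = s then (if y = s then (1 : ℂ) else 0) else (if y = s then 0 else g x y)).submatrix
      (fun o : Option α => o.elim s R) (fun o : Option α => o.elim s C)).det =
      (g.submatrix R C).det := by
  classical
  set M := (Matrix.of fun x y : ι =>
        if x = s then (if y = s then (1 : ℂ) else 0) else (if y = s then 0 else g x y)).submatrix
      (fun o : Option α => o.elim s R) (fun o : Option α => o.elim s C) with hM
  have hre : Matrix.reindex (Equiv.optionEquivSumPUnit.{0} α) (Equiv.optionEquivSumPUnit.{0} α) M =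
      Matrix.fromBlocks (g.submatrix R C) 0 0 (1 : Matrix PUnit.{1} PUnit.{1} ℂ) := by
    ext (a | a) (b | b)
    · simp [hM, Matrix.reindex_apply, submatrix_apply, hR a, hC b]
    · simp [hM, Matrix.reindex_apply, submatrix_apply, hR a]
    · simp [hM, Matrix.reindex_apply, submatrix_apply, hC b]
    · simp [hM, Matrix.reindex_apply, submatrix_apply]
  rw [← Matrix.det_reindex_self (Equiv.optionEquivSumPUnit.{0} α) M, hre, det_fromBlocks_zero₂₁,
    det_one, mul_one]

omit [Fintype ι] in
/-- CONE LEMMA: if `(L, L')` is good and the symbol `s` is used by no member of either family, then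
the pair of cones `(s * L, s * L')` (apex in position `none`) is good. -/
theorem pairing_good_cone (L L' : κ → α → ι) (s : ι) (hs : ∀ j a, L j a ≠ s)
    (hs' : ∀ i b, L' i b ≠ s)
    (hgood : ∃ g : Matrix ι ι ℂ, (Matrix.of fun j i => (g.submatrix (L j) (L' i)).det).det ≠ 0) :
    ∃ g : Matrix ι ι ℂ, (Matrix.of fun j i => (g.submatrix (fun o : Option α => o.elim s (L j))
      (fun o : Option α => o.elim s (L' i))).det).det ≠ 0 := by
  classical
  obtain ⟨g, hg⟩ := hgood
  refine ⟨Matrix.of fun x y : ι =>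
    if x = s then (if y = s then (1 : ℂ) else 0) else (if y = s then 0 else g x y), ?_⟩
  have : (Matrix.of fun j i => ((Matrix.of fun x y : ι =>
      if x = s then (if y = s then (1 : ℂ) else 0) else (if y = s then 0 else g x y)).submatrix
        (fun o : Option α => o.elim s (L j)) (fun o : Option α => o.elim s (L' i))).det) =
      Matrix.of fun j i => (g.submatrix (L j) (L' i)).det := by
    ext j i
    simp only [of_apply]
    exact det_cone_minor g s (L j) (L' i) (hs j) (hs' i)
  rw [this]
  exact hg

/-! ## 3. The pair split -/

omit [Fintype ι] in
/-- One block of the split: with rows `x` and `y` of `g` replaced by unit vectors, the minor on a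
cone over `x` (rows) against a cone over `x` (columns) is the link minor of `g`. -/
theorem det_split_minor_same (g : Matrix ι ι ℂ) (x y : ι) (R C : α → ι)
    (hRx : ∀ a, R a ≠ x) (hCx : ∀ b, C b ≠ x) (hRy : ∀ a, R a ≠ y) :
    ((Matrix.of fun p q : ι =>
        if p = x then (if q = x then (1 : ℂ) else 0)
        else if p = y then (if q = y then (1 : ℂ) else 0) else g p q).submatrix
      (fun o : Option α => o.elim x R) (fun o : Option α => o.elim x C)).det =
      (g.submatrix R C).det := by
  classical
  set M := (Matrix.of fun p q : ι =>
        if p = x then (if q = x then (1 : ℂ) else 0)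
        else if p = y then (if q = y then (1 : ℂ) else 0) else g p q).submatrix
      (fun o : Option α => o.elim x R) (fun o : Option α => o.elim x C) with hM
  have hre : Matrix.reindex (Equiv.optionEquivSumPUnit.{0} α) (Equiv.optionEquivSumPUnit.{0} α) M =
      Matrix.fromBlocks (g.submatrix R C) (Matrix.of fun (a : α) (_ : PUnit.{1}) => M (some a) none) 0
        (1 : Matrix PUnit.{1} PUnit.{1} ℂ) := by
    ext (a | a) (b | b)
    · simp [hM, Matrix.reindex_apply, submatrix_apply, hRx a, hRy a]
    · simp [Matrix.reindex_apply]
    · simp [hM, Matrix.reindex_apply, submatrix_apply, hCx b]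
    · simp [hM, Matrix.reindex_apply, submatrix_apply]
  rw [← Matrix.det_reindex_self (Equiv.optionEquivSumPUnit.{0} α) M, hre, det_fromBlocks_zero₂₁,
    det_one, mul_one]

omit [Fintype ι] in
/-- The off-diagonal blocks of the split vanish: a cone over `x` (rows) against a cone over `y`
(columns avoiding `x`) has the zero row `x`. -/
theorem det_split_minor_cross (g : Matrix ι ι ℂ) (x y : ι) (hxy : x ≠ y) (R C : α → ι)
    (hCx : ∀ b, C b ≠ x) :
    ((Matrix.of fun p q : ι =>
        if p = x then (if q = x then (1 : ℂ) else 0)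
        else if p = y then (if q = y then (1 : ℂ) else 0) else g p q).submatrix
      (fun o : Option α => o.elim x R) (fun o : Option α => o.elim y C)).det = 0 := by
  classical
  refine det_eq_zero_of_row_eq_zero none fun o => ?_
  cases o with
  | none => simp [submatrix_apply, hxy.symm]
  | some b => simp [submatrix_apply, hCx b]

omit [Fintype ι] in
/-- The symmetric off-diagonal block: a cone over `y` (rows) against a cone over `x` (columns
avoiding `y`) has the zero row `y`. -/
theorem det_split_minor_cross' (g : Matrix ι ι ℂ) (x y : ι) (hxy : x ≠ y) (R C : α → ι)
    (hCy : ∀ b, C b ≠ y) :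
    ((Matrix.of fun p q : ι =>
        if p = x then (if q = x then (1 : ℂ) else 0)
        else if p = y then (if q = y then (1 : ℂ) else 0) else g p q).submatrix
      (fun o : Option α => o.elim y R) (fun o : Option α => o.elim x C)).det = 0 := by
  classical
  refine det_eq_zero_of_row_eq_zero none fun o => ?_
  cases o with
  | none => simp [submatrix_apply, hxy, hxy.symm]
  | some b => simp [submatrix_apply, hxy.symm, hCy b]

omit [Fintype ι] in
/-- PAIR SPLIT.  Two distinct symbols `x ≠ y`; on both sides the `κ₁`-indexed members are cones
over `x` and the `κ₂`-indexed members are cones over `y`, with links avoiding `x` and `y`.  If the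
two link pairings `(L₁, L₁')` and `(L₂, L₂')` are good, the whole pairing (indexed by `κ₁ ⊕ κ₂`
on both sides) is good.  For transversal families split along a site this is the cell's four-way
balanced split (diagonal case; the anti-diagonal case is the same statement after swapping the
roles of `x` and `y` on one side via `pairing_good_of_iso`). -/
theorem pairing_good_split {κ₁ κ₂ : Type*} [Fintype κ₁] [DecidableEq κ₁] [Fintype κ₂]
    [DecidableEq κ₂] (x y : ι) (hxy : x ≠ y)
    (L₁ L₁' : κ₁ → α → ι) (L₂ L₂' : κ₂ → α → ι)
    (h₁x : ∀ j a, L₁ j a ≠ x) (h₁y : ∀ j a, L₁ j a ≠ y)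
    (h₁'x : ∀ i b, L₁' i b ≠ x) (h₁'y : ∀ i b, L₁' i b ≠ y)
    (h₂x : ∀ j a, L₂ j a ≠ x) (h₂y : ∀ j a, L₂ j a ≠ y)
    (h₂'x : ∀ i b, L₂' i b ≠ x) (h₂'y : ∀ i b, L₂' i b ≠ y)
    (hg₁ : ∃ g : Matrix ι ι ℂ, (Matrix.of fun j i => (g.submatrix (L₁ j) (L₁' i)).det).det ≠ 0)
    (hg₂ : ∃ g : Matrix ι ι ℂ, (Matrix.of fun j i => (g.submatrix (L₂ j) (L₂' i)).det).det ≠ 0) :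
    ∃ g : Matrix ι ι ℂ, (Matrix.of fun j i =>
      (g.submatrix
        (Sum.elim (fun j₁ => fun o : Option α => o.elim x (L₁ j₁))
                  (fun j₂ => fun o : Option α => o.elim y (L₂ j₂)) j)
        (Sum.elim (fun i₁ => fun o : Option α => o.elim x (L₁' i₁))
                  (fun i₂ => fun o : Option α => o.elim y (L₂' i₂)) i)).det).det ≠ 0 := by
  classical
  obtain ⟨g, hg1, hg2⟩ := pairing_good_and L₁ L₁' L₂ L₂' hg₁ hg₂
  set G : Matrix ι ι ℂ := Matrix.of fun p q : ι =>
        if p = x then (if q = x then (1 : ℂ) else 0)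
        else if p = y then (if q = y then (1 : ℂ) else 0) else g p q with hG
  refine ⟨G, ?_⟩
  -- the pairing matrix of G is block diagonal with the two link pairings of g
  have hblock : (Matrix.of fun j i =>
      (G.submatrix
        (Sum.elim (fun j₁ => fun o : Option α => o.elim x (L₁ j₁))
                  (fun j₂ => fun o : Option α => o.elim y (L₂ j₂)) j)
        (Sum.elim (fun i₁ => fun o : Option α => o.elim x (L₁' i₁))
                  (fun i₂ => fun o : Option α => o.elim y (L₂' i₂)) i)).det) =
      Matrix.fromBlocks (Matrix.of fun j i => (g.submatrix (L₁ j) (L₁' i)).det) 0 0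
        (Matrix.of fun j i => (g.submatrix (L₂ j) (L₂' i)).det) := by
    ext (j | j) (i | i)
    · simp only [of_apply, Sum.elim_inl, fromBlocks_apply₁₁]
      exact det_split_minor_same g x y (L₁ j) (L₁' i) (h₁x j) (h₁'x i) (h₁y j)
    · simp only [of_apply, Sum.elim_inl, Sum.elim_inr, fromBlocks_apply₁₂, Matrix.zero_apply]
      exact det_split_minor_cross g x y hxy (L₁ j) (L₂' i) (h₂'x i)
    · simp only [of_apply, Sum.elim_inl, Sum.elim_inr, fromBlocks_apply₂₁, Matrix.zero_apply]
      exact det_split_minor_cross' g x y hxy (L₂ j) (L₁' i) (h₁'y i)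
    · simp only [of_apply, Sum.elim_inr, fromBlocks_apply₂₂]
      -- symmetric role of y: swap the two `if`s of G
      have hG' : G = Matrix.of fun p q : ι =>
          if p = y then (if q = y then (1 : ℂ) else 0)
          else if p = x then (if q = x then (1 : ℂ) else 0) else g p q := by
        ext p q
        simp only [hG, of_apply]
        by_cases hpx : p = x
        · subst hpx; simp [hxy]
        · simp [hpx]
      rw [hG']
      exact det_split_minor_same g y x (L₂ j) (L₂' i) (h₂y j) (h₂'y i) (h₂x j)
  rw [hblock, det_fromBlocks_zero₂₁]
  exact mul_ne_zero hg1 hg2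

end Summit.ValiantsHypothesis.ValiantsHypothesis.Theorems.BarrierLever.Compression
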